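import Summits.CriticalPhenomena.PercolationContinuityZ3.Theorems.PercNearOneGluingNoHeavyLowerTailRKNS3
import Summits.CriticalPhenomena.PercolationContinuityZ3.Theorems.PercNearOneGluingNoHeavyLowerTailNearOneConvexGluing
import HarnessLib

/-!
# `NoHeavyLowerTail` (stmt-CriticalPhenomena-4575) — the SLACK-FREE fully-refined row `B³_k` (harness `gen7-Q7REF3N`):
# `B³ ≥ 0 ⟹ KN Question 7 at the designated relay`, and `B³ ≥ 0` on near-one instances `⟹ NoHeavyLowerTail`

Support file (seat `prim-ineq-gen-7`, `--supports stmt-CriticalPhenomena-4575`). No definitions, no sorries.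

`B³_S`-sum := `Σ_{∅≠S⊆A∖z} [(A⁺⁺_S/P⁺_S) m_S − (A⁻_S/P⁻_S) m_R]` is the fully-refined row of `…RKNS3` WITHOUT the event-gluing slack `Z = μ(o↮A, z↮c)`.
By `RKNS3.X_ge_sum3`, `B³ ≤ X := μ(o↔A, o↔c) − μ(o↔A, z↔c)`, so `B³ ≥ 0` gives Kozma–Nitzan's Question 7 / inequality (3) at the relay `z`
(`knQ7_at_of_b3`), which is stronger than event gluing; and since `Z ≥ 0`, `B³ ≥ 0` on the near-one instances implies the hypothesis of
`noHeavyLowerTail_of_rkns3_nearOne` (`noHeavyLowerTail_of_b3_nearOne`).  Seat census (FINDING-RKNSK.md §7): `B³ ≥ 0` is FALSE unrestricted (0.2 % of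
random instances) but has 0 violations on ≈1.6 M near-one instances (δ₀ = 0.2/0.3; star-like families k ≤ 8, generic graphs k = 3,4, hypergraph laws) and its
k = 3 instance cuts both near-one U13 pseudo-laws of the wf3lp programme.
[cite: KozmaNitzan2024, Question 7 (§5.5, p. 36), inequality (3) (p. 3); VandenbergHaggstromKahn2005, Thms. 1.3–1.4 (pp. 6–7)]
-/

namespace Summit.CriticalPhenomena.PercolationContinuityZ3.Theorems

open MeasureTheory Set Literature.Probability.LatticeModels Literature.Probability.Percolation

noncomputable section
open Classical

variable {n : ℕ}

/-- **`B³ ≥ 0 ⟹ KN Question 7 at `z`**: for `o, c ∉ A`, `o ≠ c`, `z ∈ A`, nonnegativity of the slack-free fully-refined row gives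
`μ(o↔A, z↔c) ≤ μ(o↔A, o↔c)`. [this file] -/
theorem knQ7_at_of_b3 (w : Sym2 (Fin n) → unitInterval) (A : Finset (Fin n)) (o c z : Fin n)
    (ho : o ∉ A) (hc : c ∉ A) (hoc : o ≠ c) (hz : z ∈ A)
    (hB : 0 ≤ ∑ S ∈ (A.erase z).powerset.filter (fun S => S.Nonempty),
      ((prodBernoulli w).real
          ({ω : BondConfig (Fin n) | ∀ s ∈ insert c (insert o S), ∀ x ∈ A \ S, ¬ (openGraph ω).Reachable s x} ∩
            ⋃ s ∈ insert c S, (openConn s o : Set (BondConfig (Fin n)))) /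
        (prodBernoulli w).real {ω : BondConfig (Fin n) | ∀ s ∈ insert c (insert o S), ∀ x ∈ A \ S, ¬ (openGraph ω).Reachable s x} *
        (prodBernoulli w).real
            ({ω : BondConfig (Fin n) | ∀ s ∈ insert o S, ∀ x ∈ A \ S, ¬ (openGraph ω).Reachable s x} ∩
              ⋂ s ∈ S, (openConn s c : Set (BondConfig (Fin n)))) -
      (prodBernoulli w).real
          ({ω : BondConfig (Fin n) | ∀ s ∈ insert o S, ∀ x ∈ insert c (A \ S), ¬ (openGraph ω).Reachable s x} ∩
            ⋃ s ∈ S, (openConn s o : Set (BondConfig (Fin n)))) /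
        (prodBernoulli w).real {ω : BondConfig (Fin n) | ∀ s ∈ insert o S, ∀ x ∈ insert c (A \ S), ¬ (openGraph ω).Reachable s x} *
        (prodBernoulli w).real
            ({ω : BondConfig (Fin n) | ∀ s ∈ insert o S, ∀ x ∈ A \ S, ¬ (openGraph ω).Reachable s x} ∩
              ⋂ x ∈ A \ S, (openConn x c : Set (BondConfig (Fin n)))))) :
    (prodBernoulli w).real ((⋃ a ∈ A, (openConn o a : Set (BondConfig (Fin n)))) ∩ openConn z c) ≤
      (prodBernoulli w).real ((⋃ a ∈ A, (openConn o a : Set (BondConfig (Fin n)))) ∩ openConn o c) := by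
  have hX := RKNS3.X_ge_sum3 w A o c z ho hc hoc hz
  linarith

/-- **`B³ ≥ 0` on near-one instances ⟹ `NoHeavyLowerTail`** (any fixed `δ₀ > 0`): since the slack `μ(o↮A, z↮c)` is nonnegative, the slack-free row
dominates the fully-refined row, and the near-one composition of `…RKNS3NearOne` applies verbatim. [this file] -/
theorem noHeavyLowerTail_of_b3_nearOne (δ₀ : ℝ) (hδ₀ : 0 < δ₀)
    (hB : ∀ (n : ℕ) (w : Sym2 (Fin n) → unitInterval) (A : Finset (Fin n)) (o c z : Fin n),
      o ∉ A → c ∉ A → o ≠ c → z ∈ A →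
      (∀ a ∈ A, (prodBernoulli w).real (openConn z c) ≤ (prodBernoulli w).real (openConn a c)) →
      1 - δ₀ ≤ (prodBernoulli w).real (⋃ a ∈ insert c A, (openConn o a : Set (BondConfig (Fin n)))) →
      (∀ a ∈ A, ∀ a' ∈ A, 1 - δ₀ ≤ (prodBernoulli w).real (openConn a a' : Set (BondConfig (Fin n)))) →
      (∀ a ∈ A, (prodBernoulli w).real (openConn a c : Set (BondConfig (Fin n)))ᶜ ≤ δ₀) →
      0 ≤ ∑ S ∈ (A.erase z).powerset.filter (fun S => S.Nonempty),
        ((prodBernoulli w).real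
            ({ω : BondConfig (Fin n) | ∀ s ∈ insert c (insert o S), ∀ x ∈ A \ S, ¬ (openGraph ω).Reachable s x} ∩
              ⋃ s ∈ insert c S, (openConn s o : Set (BondConfig (Fin n)))) /
          (prodBernoulli w).real {ω : BondConfig (Fin n) | ∀ s ∈ insert c (insert o S), ∀ x ∈ A \ S, ¬ (openGraph ω).Reachable s x} *
          (prodBernoulli w).real
              ({ω : BondConfig (Fin n) | ∀ s ∈ insert o S, ∀ x ∈ A \ S, ¬ (openGraph ω).Reachable s x} ∩
                ⋂ s ∈ S, (openConn s c : Set (BondConfig (Fin n)))) -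
        (prodBernoulli w).real
            ({ω : BondConfig (Fin n) | ∀ s ∈ insert o S, ∀ x ∈ insert c (A \ S), ¬ (openGraph ω).Reachable s x} ∩
              ⋃ s ∈ S, (openConn s o : Set (BondConfig (Fin n)))) /
          (prodBernoulli w).real {ω : BondConfig (Fin n) | ∀ s ∈ insert o S, ∀ x ∈ insert c (A \ S), ¬ (openGraph ω).Reachable s x} *
          (prodBernoulli w).real
              ({ω : BondConfig (Fin n) | ∀ s ∈ insert o S, ∀ x ∈ A \ S, ¬ (openGraph ω).Reachable s x} ∩
                ⋂ x ∈ A \ S, (openConn x c : Set (BondConfig (Fin n)))))) :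
    Summit.CriticalPhenomena.PercolationContinuityZ3.Theses.PercNearOneGluing.NoHeavyLowerTail := by
  refine noHeavyLowerTail_of_manyFingersLargePocket
    (manyFingersLargePocket_of_nearOneGluing
      (NearOneConvexGluing.nearOneGluing_of_eventGluingNearOne 1 δ₀ zero_le_one hδ₀ ?_))
  intro n w A o c s hs hsδ hregA hregP hcut
  rw [one_mul]
  by_cases hoc : o = c
  · subst hoc
    have hempty : ((openConn o o : Set (BondConfig (Fin n)))ᶜ ∩ ⋃ a ∈ A, openConn o a) = ∅ := by
      ext ω
      simp only [mem_inter_iff, mem_compl_iff, mem_empty_iff_false, iff_false, not_and]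
      intro h; exact absurd (show ω ∈ (openConn o o : Set (BondConfig (Fin _))) from SimpleGraph.Reachable.refl o) h
    rw [hempty, measureReal_empty]; exact hs
  by_cases hoA : o ∈ A
  · calc (prodBernoulli w).real ((openConn o c : Set (BondConfig (Fin n)))ᶜ ∩ ⋃ a ∈ A, openConn o a)
        ≤ (prodBernoulli w).real ((openConn o c : Set (BondConfig (Fin n)))ᶜ) :=
          measureReal_mono (h₂ := measure_ne_top _ _) inter_subset_left
      _ ≤ s := hcut o hoA
  set A' : Finset (Fin n) := A.erase c with hA'
  have hAsub : A ⊆ insert c A' := by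
    intro x hx
    by_cases hxc : x = c
    · subst hxc; exact Finset.mem_insert_self _ _
    · exact Finset.mem_insert_of_mem (by rw [hA', Finset.mem_erase]; exact ⟨hxc, hx⟩)
  have hsub : ((openConn o c : Set (BondConfig (Fin n)))ᶜ ∩ ⋃ a ∈ A, openConn o a) ⊆
      (⋃ a ∈ A', (openConn o a : Set (BondConfig (Fin n)))) \ openConn o c := by
    rintro ω ⟨hoc', hU⟩
    simp only [mem_iUnion, exists_prop] at hU
    obtain ⟨a, haA, hoa⟩ := hU
    refine ⟨?_, hoc'⟩
    simp only [mem_iUnion, exists_prop]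
    refine ⟨a, ?_, hoa⟩
    rw [hA', Finset.mem_erase]
    refine ⟨?_, haA⟩
    rintro rfl; exact hoc' hoa
  refine (measureReal_mono (h₂ := measure_ne_top _ _) hsub).trans ?_
  by_cases hne : A'.Nonempty
  swap
  · rw [Finset.not_nonempty_iff_eq_empty] at hne
    have hempty : ((⋃ a ∈ A', (openConn o a : Set (BondConfig (Fin n)))) \ openConn o c) = ∅ := by
      rw [hne]; simp
    rw [hempty, measureReal_empty]; exact hs
  obtain ⟨z, hzA', hzmin⟩ := Finset.exists_min_image A' (fun a => (prodBernoulli w).real (openConn a c)) hne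
  have hoA' : o ∉ A' := fun h => hoA (Finset.mem_of_mem_erase h)
  have hcA' : c ∉ A' := by rw [hA']; exact Finset.notMem_erase c A
  have hregA' : 1 - δ₀ ≤ (prodBernoulli w).real (⋃ a ∈ insert c A', (openConn o a : Set (BondConfig (Fin n)))) :=
    hregA.trans (measureReal_mono (h₂ := measure_ne_top _ _) (Set.biUnion_subset_biUnion_left fun a ha => hAsub ha))
  have hregP' : ∀ a ∈ A', ∀ a' ∈ A', 1 - δ₀ ≤ (prodBernoulli w).real (openConn a a' : Set (BondConfig (Fin n))) :=
    fun a ha a' ha' => hregP a (Finset.mem_of_mem_erase ha) a' (Finset.mem_of_mem_erase ha')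
  have hcut' : ∀ a ∈ A', (prodBernoulli w).real (openConn a c : Set (BondConfig (Fin n)))ᶜ ≤ δ₀ :=
    fun a ha => (hcut a (Finset.mem_of_mem_erase ha)).trans hsδ
  have hB' := hB n w A' o c z hoA' hcA' hoc hzA' hzmin hregA' hregP' hcut'
  have hZ : 0 ≤ (prodBernoulli w).real ((⋃ a ∈ A', (openConn o a : Set (BondConfig (Fin n))))ᶜ ∩ (openConn z c)ᶜ) :=
    measureReal_nonneg
  have hEG := eventGluing_of_rkns3_at w A' o c z hoA' hcA' hoc hzA' (by linarith)
  exact hEG.trans (hcut z (Finset.mem_of_mem_erase hzA'))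

end

end Summit.CriticalPhenomena.PercolationContinuityZ3.Theorems
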